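import Summits.Ventures.PercRepro.RankLevelSetDepCountMult
import Summits.Ventures.PercRepro.S2IndepCount

/-!
# PercRepro — THE `U`-COUNT WITH THEOREM M's MULTIPLICITY: EVERY RANK-`q` SET OF `m` ELEMENTS CONTAINS
`≥ j₀·(C(m − q, j₀) − (2^{j₀−1} − j₀)·C(m − q, j₀ − 1))` PAIRS (p4, gen 17; night-1's RankLevelSetDepCountMult with the
multiplicity of `S2.card_spanF_ge_indep` (S2IndepCount) in place of the `m − q` fundamental-circuit pairs; a feeder for the S4
rows `q ≥ 10`, owner p9)

night-1's `ncard_eRk_eq_ncard_eq_mul_le` charges every pair `(C, B')` its fibre and counts a set `B` once per pair inside it —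
`≥ m − q` pairs (the fundamental circuits of a basis). With the flat bound `|Y| + 1 ≤ 2^{r(Y)}` (`hsp`) the spanning `(q+1)`-subsets of `B` number
`≥ L(m − q) = j₀·(C(m − q, j₀) − (2^{j₀−1} − j₀)·C(m − q, j₀ − 1))` for every `j₀ ≥ 1` (`S2.card_spanF_ge_indep`: THEOREM M
and the count of the independent `j₀`-subsets of the extras), and every spanning
`(q+1)`-subset is the union of exactly one pair (night-1's `exists_circuit_extension_exact`), so the factor becomes
`L(m − q)`:

  `L(m − q) · #{B ⊆ E : r(B) = q, |B| = m} ≤ C(f' − q, m − q − 1) · Σ_k s_k·C(n, q+1−k) + C(f − q − 1, m − q − 1) · Σ_k s_k·C((q+1)d, q+1−k)`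

(`ncard_eRk_eq_ncard_eq_mul_le_indep`). In an assembly the weights `1/(m − q)` become `1/L(m − q)` (or `1/max(cube, L)`), whose
sums are bounded in closed form by S2MultWeightSumsB (`sum_Ico_choose_div_choose_succ_le`, `mul_choose_le_two_mul_indepBound`). Everything but the multiplicity step is night-1's
proof byte for byte. Axioms: standard.
-/

open scoped Matroid

namespace PercRepro

namespace Matroid

open Set

variable {α : Type} {M : _root_.Matroid α}

/-- **THE WEIGHTED `U`-COUNT WITH THEOREM M's MULTIPLICITY**: with every circuit of `≥ 3` elements, the flat bound
`|Y| + 1 ≤ 2^{r(Y)}`, every set of rank `≤ q` of `≤ f` points, every set of rank `≤ q − 1` of `≤ f'` points and `|E| = r(M) + d`,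
for every `m` (trivial for `m ≤ q`) and every `j₀ ≥ 1`: `L(m − q) · #{B ⊆ E : r(B) = q, |B| = m} ≤ C(f' − q, m − q − 1) · Σ_k s_k·C(n, q+1−k) + C(f − q − 1, m − q − 1) · Σ_k s_k·C((q+1)d, q+1−k)`. -/
theorem ncard_eRk_eq_ncard_eq_mul_le_indep (M : _root_.Matroid α) [M.Finite] (q f f' : ℕ) (hq : 1 ≤ q)
    (hcirc : ∀ C, M.IsCircuit C → 3 ≤ C.encard)
    (hsp : ∀ k : ℕ, ∀ Y ⊆ M.E, M.eRk Y ≤ k → Y.ncard + 1 ≤ 2 ^ k) (j₀ : ℕ) (hj : 1 ≤ j₀)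
    (hflat : ∀ X ⊆ M.E, M.eRk X ≤ q → X.ncard ≤ f)
    (hflat' : ∀ X ⊆ M.E, M.eRk X ≤ (q - 1 : ℕ) → X.ncard ≤ f') {d : ℕ} (hd : M.E.encard = M.eRank + d)
    (m : ℕ) :
    (j₀ * ((m - q).choose j₀ - (2 ^ (j₀ - 1) - j₀) * (m - q).choose (j₀ - 1))) * {B : Set α | B ⊆ M.E ∧ M.eRk B = q ∧ B.ncard = m}.ncard ≤
      Nat.choose (f' - q) (m - (q + 1)) *
          (∑ k ∈ Finset.Icc 3 (q + 1),
            {C | M.IsCircuit C ∧ C.ncard = k}.ncard * M.E.ncard.choose (q + 1 - k)) +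
        Nat.choose (f - (q + 1)) (m - (q + 1)) *
          (∑ k ∈ Finset.Icc 3 (q + 1),
            {C | M.IsCircuit C ∧ C.ncard = k}.ncard * ((q + 1) * d).choose (q + 1 - k)) := by
  classical
  set Ef := M.ground_finite.toFinset with hEf
  have hE : (Ef : Set α) = M.E := Set.Finite.coe_toFinset _
  have hEcard : Ef.card = M.E.ncard := (Set.ncard_eq_toFinset_card _ M.ground_finite).symm
  -- the union of the short circuits
  set S₀ := ⋃₀ circuitsLE M (q + 1) with hS₀
  have hS₀E : S₀ ⊆ M.E := by
    intro x hx
    obtain ⟨C, hC, hxC⟩ := mem_sUnion.1 hx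
    exact subset_ground_of_mem_circuitsLE hC hxC
  have hS₀fin : S₀.Finite := M.ground_finite.subset hS₀E
  set Sf := hS₀fin.toFinset with hSf
  have hScard : Sf.card ≤ (q + 1) * d := by
    have h := encard_sUnion_circuitsLE_le (M := M) (k := q + 1) (d := d) hd
    rw [← hS₀fin.cast_ncard_eq, Set.ncard_eq_toFinset_card _ hS₀fin] at h
    exact_mod_cast h
  -- the sets of size `m`
  set U := {B : Set α | B ⊆ M.E ∧ M.eRk B = q ∧ B.ncard = m} with hU
  have hUfin : U.Finite := M.ground_finite.finite_subsets.subset (fun B hB => hB.1)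
  set Uf := hUfin.toFinset with hUf
  have hUfcard : Uf.card = U.ncard := (Set.ncard_eq_toFinset_card _ hUfin).symm
  have hmemUf : ∀ B, B ∈ Uf ↔ B ⊆ M.E ∧ M.eRk B = q ∧ B.ncard = m := by
    intro B; rw [hUf, Set.Finite.mem_toFinset]; exact Iff.rfl
  -- the circuits of each size, the subsets of `E` and of `S₀` of each size
  have hcircfin : ∀ k : ℕ, {C | M.IsCircuit C ∧ C.ncard = k}.Finite := fun k =>
    M.ground_finite.finite_subsets.subset (fun C hC => hC.1.subset_ground)
  set 𝒞 : ℕ → Finset (Set α) := fun k => (hcircfin k).toFinset with h𝒞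
  set 𝓑 : ℕ → Finset (Set α) := fun j => (Ef.powersetCard j).image (fun s : Finset α => (s : Set α)) with h𝓑
  set 𝓑S : ℕ → Finset (Set α) := fun j => (Sf.powersetCard j).image (fun s : Finset α => (s : Set α)) with h𝓑S
  have h𝓑card : ∀ j, (𝓑 j).card ≤ M.E.ncard.choose j := by
    intro j
    calc (𝓑 j).card ≤ (Ef.powersetCard j).card := Finset.card_image_le
      _ = Ef.card.choose j := Finset.card_powersetCard j Ef
      _ = M.E.ncard.choose j := by rw [hEcard]
  have h𝓑Scard : ∀ j, (𝓑S j).card ≤ ((q + 1) * d).choose j := by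
    intro j
    calc (𝓑S j).card ≤ (Sf.powersetCard j).card := Finset.card_image_le
      _ = Sf.card.choose j := Finset.card_powersetCard j Sf
      _ ≤ ((q + 1) * d).choose j := Nat.choose_le_choose j hScard
  have h𝒞card : ∀ k, (𝒞 k).card = {C | M.IsCircuit C ∧ C.ncard = k}.ncard := fun k =>
    (Set.ncard_eq_toFinset_card _ (hcircfin k)).symm
  have hmem𝓑 : ∀ (j : ℕ) (B' : Set α), B' ⊆ M.E → B'.ncard = j → B' ∈ 𝓑 j := by
    intro j B' hB'E hB'
    have hB'fin : B'.Finite := M.ground_finite.subset hB'E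
    rw [h𝓑, Finset.mem_image]
    refine ⟨hB'fin.toFinset, ?_, by simp⟩
    rw [Finset.mem_powersetCard]
    refine ⟨?_, by rw [← Set.ncard_eq_toFinset_card B' hB'fin]; exact hB'⟩
    intro x hx
    rw [Set.Finite.mem_toFinset] at hx
    rw [hEf, Set.Finite.mem_toFinset]
    exact hB'E hx
  have hmem𝓑S : ∀ (j : ℕ) (B' : Set α), B' ⊆ S₀ → B'.ncard = j → B' ∈ 𝓑S j := by
    intro j B' hB'S hB'
    have hB'fin : B'.Finite := hS₀fin.subset hB'S
    rw [h𝓑S, Finset.mem_image]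
    refine ⟨hB'fin.toFinset, ?_, by simp⟩
    rw [Finset.mem_powersetCard]
    refine ⟨?_, by rw [← Set.ncard_eq_toFinset_card B' hB'fin]; exact hB'⟩
    intro x hx
    rw [Set.Finite.mem_toFinset] at hx
    rw [hSf, Set.Finite.mem_toFinset]
    exact hB'S hx
  -- the pairs OF RANK EXACTLY `q`
  set P : Finset (Set α × Set α) :=
    ((Finset.Icc 3 (q + 1)).biUnion (fun k => 𝒞 k ×ˢ 𝓑 (q + 1 - k))).filter
      (fun p => Disjoint p.2 p.1 ∧ M.eRk (p.1 ∪ p.2) = q) with hP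
  set Psmall := P.filter (fun p => (M.closure (p.1 ∪ p.2)).ncard ≤ f' + 1) with hPsmall
  set Pbig := P.filter (fun p => ¬ (M.closure (p.1 ∪ p.2)).ncard ≤ f' + 1) with hPbig
  -- the data of a pair
  have hpair : ∀ p ∈ P, p.1 ⊆ M.E ∧ p.2 ⊆ M.E ∧ (p.1 ∪ p.2).ncard = q + 1 ∧ M.eRk (p.1 ∪ p.2) = q ∧
      ∃ k, k ∈ Finset.Icc 3 (q + 1) ∧ p.1 ∈ 𝒞 k ∧ p.2.ncard = q + 1 - k := by
    intro p hp
    rw [hP, Finset.mem_filter] at hp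
    obtain ⟨hpmem, hdisj, hrk⟩ := hp
    rw [Finset.mem_biUnion] at hpmem
    obtain ⟨k, hk, hpk⟩ := hpmem
    rw [Finset.mem_product] at hpk
    obtain ⟨h1, h2⟩ := hpk
    have h1' := h1
    rw [h𝒞, Set.Finite.mem_toFinset] at h1'
    rw [h𝓑, Finset.mem_image] at h2
    obtain ⟨s, hs, hs'⟩ := h2
    rw [Finset.mem_powersetCard] at hs
    have hp1E : p.1 ⊆ M.E := h1'.1.subset_ground
    have hp2E : p.2 ⊆ M.E := by rw [← hs', ← hE]; exact Finset.coe_subset.2 hs.1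
    have hp1fin : p.1.Finite := M.ground_finite.subset hp1E
    have hp2fin : p.2.Finite := M.ground_finite.subset hp2E
    have hp1c : p.1.ncard = k := h1'.2
    have hp2c : p.2.ncard = q + 1 - k := by rw [← hs', Set.ncard_coe_finset]; exact hs.2
    rw [Finset.mem_Icc] at hk
    refine ⟨hp1E, hp2E, ?_, hrk, k, Finset.mem_Icc.2 hk, h1, hp2c⟩
    rw [ncard_union_eq hdisj.symm hp1fin hp2fin, hp1c, hp2c]
    omega
  -- (1) the fibre of a pair at size `m` is bounded by the exact-size fibre in `cl U`
  have hfib : ∀ p ∈ P, ∀ m', (M.closure (p.1 ∪ p.2) \ (p.1 ∪ p.2)).ncard ≤ m' →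
      (Uf.filter (fun B => p.1 ∪ p.2 ⊆ B)).card ≤ Nat.choose m' (m - (q + 1)) := by
    intro p hp m' hm'
    obtain ⟨hp1E, hp2E, hU', hrk, -⟩ := hpair p hp
    have hUE : p.1 ∪ p.2 ⊆ M.E := union_subset hp1E hp2E
    have hFfin : (M.closure (p.1 ∪ p.2)).Finite :=
      M.ground_finite.subset (M.closure_subset_ground _)
    have hsub : ((Uf.filter (fun B => p.1 ∪ p.2 ⊆ B)) : Set (Set α)) ⊆
        {B : Set α | p.1 ∪ p.2 ⊆ B ∧ B ⊆ M.closure (p.1 ∪ p.2) ∧ B.ncard = m} := by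
      intro B hB
      rw [Finset.mem_coe, Finset.mem_filter, hmemUf] at hB
      exact ⟨hB.2, subset_closure_of_eRk_eq hB.2 hB.1.1 hrk hB.1.2.1, hB.1.2.2⟩
    calc (Uf.filter (fun B => p.1 ∪ p.2 ⊆ B)).card
        = ((Uf.filter (fun B => p.1 ∪ p.2 ⊆ B)) : Set (Set α)).ncard := (Set.ncard_coe_finset _).symm
      _ ≤ {B : Set α | p.1 ∪ p.2 ⊆ B ∧ B ⊆ M.closure (p.1 ∪ p.2) ∧ B.ncard = m}.ncard :=
          ncard_le_ncard hsub (hFfin.finite_subsets.subset (fun B hB => hB.2.1))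
      _ ≤ Nat.choose m' (m - (q + 1)) := ncard_fibre_eq_le hFfin hU' hm' m
  have hfib_small : ∀ p ∈ Psmall,
      (Uf.filter (fun B => p.1 ∪ p.2 ⊆ B)).card ≤ Nat.choose (f' - q) (m - (q + 1)) := by
    intro p hp
    rw [hPsmall, Finset.mem_filter] at hp
    obtain ⟨hpP, hsmall⟩ := hp
    obtain ⟨hp1E, hp2E, hU', hrk, -⟩ := hpair p hpP
    have hUE : p.1 ∪ p.2 ⊆ M.E := union_subset hp1E hp2E
    have hFfin : (M.closure (p.1 ∪ p.2)).Finite :=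
      M.ground_finite.subset (M.closure_subset_ground _)
    have hUF : p.1 ∪ p.2 ⊆ M.closure (p.1 ∪ p.2) := M.subset_closure _ hUE
    refine hfib p hpP _ ?_
    rw [ncard_sdiff hUF (hFfin.subset hUF), hU']
    omega
  have hfib_big : ∀ p ∈ Pbig,
      (Uf.filter (fun B => p.1 ∪ p.2 ⊆ B)).card ≤ Nat.choose (f - (q + 1)) (m - (q + 1)) := by
    intro p hp
    rw [hPbig, Finset.mem_filter] at hp
    obtain ⟨hpP, -⟩ := hp
    obtain ⟨hp1E, hp2E, hU', hrk, -⟩ := hpair p hpP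
    have hUE : p.1 ∪ p.2 ⊆ M.E := union_subset hp1E hp2E
    have hFfin : (M.closure (p.1 ∪ p.2)).Finite :=
      M.ground_finite.subset (M.closure_subset_ground _)
    have hFf : (M.closure (p.1 ∪ p.2)).ncard ≤ f :=
      hflat _ (M.closure_subset_ground _) (by rw [M.eRk_closure_eq, hrk])
    have hUF : p.1 ∪ p.2 ⊆ M.closure (p.1 ∪ p.2) := M.subset_closure _ hUE
    refine hfib p hpP _ ?_
    rw [ncard_sdiff hUF (hFfin.subset hUF), hU']
    omega
  -- (2) the big pairs live inside `S₀`
  have hPbig_sub : Pbig ⊆ (Finset.Icc 3 (q + 1)).biUnion (fun k => 𝒞 k ×ˢ 𝓑S (q + 1 - k)) := by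
    intro p hp
    rw [hPbig, Finset.mem_filter] at hp
    obtain ⟨hpP, hbig⟩ := hp
    push Not at hbig
    obtain ⟨hp1E, hp2E, hU', hrk, k, hk, h1, hp2c⟩ := hpair p hpP
    have hUE : p.1 ∪ p.2 ⊆ M.E := union_subset hp1E hp2E
    have hsub : M.closure (p.1 ∪ p.2) ⊆ S₀ :=
      big_flat_subset_sUnion_circuitsLE hq hflat' hrk.le hbig
    have hUF : p.1 ∪ p.2 ⊆ M.closure (p.1 ∪ p.2) := M.subset_closure _ hUE
    rw [Finset.mem_biUnion]
    refine ⟨k, hk, ?_⟩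
    rw [Finset.mem_product]
    exact ⟨h1, hmem𝓑S _ p.2 ((subset_union_right.trans hUF).trans hsub) hp2c⟩
  -- (3) the number of pairs
  have hPcard : P.card ≤
      ∑ k ∈ Finset.Icc 3 (q + 1), {C | M.IsCircuit C ∧ C.ncard = k}.ncard * M.E.ncard.choose (q + 1 - k) := by
    calc P.card ≤ ((Finset.Icc 3 (q + 1)).biUnion (fun k => 𝒞 k ×ˢ 𝓑 (q + 1 - k))).card :=
          Finset.card_filter_le _ _
      _ ≤ ∑ k ∈ Finset.Icc 3 (q + 1), (𝒞 k ×ˢ 𝓑 (q + 1 - k)).card := Finset.card_biUnion_le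
      _ ≤ ∑ k ∈ Finset.Icc 3 (q + 1), {C | M.IsCircuit C ∧ C.ncard = k}.ncard * M.E.ncard.choose (q + 1 - k) := by
          apply Finset.sum_le_sum
          intro k _
          rw [Finset.card_product, h𝒞card k]
          exact Nat.mul_le_mul_left _ (h𝓑card _)
  have hPbigcard : Pbig.card ≤
      ∑ k ∈ Finset.Icc 3 (q + 1), {C | M.IsCircuit C ∧ C.ncard = k}.ncard * ((q + 1) * d).choose (q + 1 - k) := by
    calc Pbig.card ≤ ((Finset.Icc 3 (q + 1)).biUnion (fun k => 𝒞 k ×ˢ 𝓑S (q + 1 - k))).card :=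
          Finset.card_le_card hPbig_sub
      _ ≤ ∑ k ∈ Finset.Icc 3 (q + 1), (𝒞 k ×ˢ 𝓑S (q + 1 - k)).card := Finset.card_biUnion_le
      _ ≤ ∑ k ∈ Finset.Icc 3 (q + 1), {C | M.IsCircuit C ∧ C.ncard = k}.ncard * ((q + 1) * d).choose (q + 1 - k) := by
          apply Finset.sum_le_sum
          intro k _
          rw [Finset.card_product, h𝒞card k]
          exact Nat.mul_le_mul_left _ (h𝓑Scard _)
  have hPsmallcard : Psmall.card ≤ P.card := Finset.card_filter_le _ _
  -- (4) every `B ∈ Uf` contains at least `L(m − q)` pairs of `P`: the spanning `(q+1)`-subsets of `B`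
  -- (`S2.card_spanF_ge_indep`) are the unions of pairs of `P` inside `B`
  have hlow : ∀ B ∈ Uf,
      j₀ * ((m - q).choose j₀ - (2 ^ (j₀ - 1) - j₀) * (m - q).choose (j₀ - 1)) ≤ (P.filter (fun p => p.1 ∪ p.2 ⊆ B)).card := by
    intro B hB
    rw [hmemUf] at hB
    obtain ⟨hBE, hBr, hBm⟩ := hB
    have hBfin : B.Finite := M.ground_finite.subset hBE
    set Bf : Finset α := hBfin.toFinset with hBfdef
    have hBfcoe : (Bf : Set α) = B := Set.Finite.coe_toFinset _
    have hBfcard : Bf.card = m := by rw [← Set.ncard_eq_toFinset_card _ hBfin, hBm]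
    have hBfE : (Bf : Set α) ⊆ M.E := by rw [hBfcoe]; exact hBE
    have hBfq : M.eRk (Bf : Set α) = (q : ℕ∞) := by rw [hBfcoe]; exact hBr
    have hind := S2.card_spanF_ge_indep q hsp hBfE hBfq j₀ hj
    rw [hBfcard] at hind
    refine hind.trans ?_
    apply Finset.card_le_card_of_surjOn (fun p : Set α × Set α => p.1 ∪ p.2)
    intro D hD
    rw [Finset.mem_coe, S2.mem_spanF] at hD
    obtain ⟨D', hD'B, hD'card, hD'q, hBcl, rfl⟩ := hD
    have hD'E : (D' : Set α) ⊆ M.E := (Finset.coe_subset.2 hD'B).trans hBfE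
    have hD'ncard : (D' : Set α).ncard = q + 1 := by rw [Set.ncard_coe_finset]; exact hD'card
    obtain ⟨C, B', hC, hCD, hB'D, hdisj, hcard, hDcl⟩ :=
      exists_circuit_extension_exact hD'E hD'q (by rw [hD'ncard]; omega)
    have hCfin : C.Finite := D'.finite_toSet.subset hCD
    have hB'fin : B'.Finite := D'.finite_toSet.subset hB'D
    have hunion_sub : C ∪ B' ⊆ (D' : Set α) := Set.union_subset hCD hB'D
    have hunion_card : (C ∪ B').ncard = q + 1 := by
      rw [Set.ncard_union_eq hdisj.symm hCfin hB'fin]; exact hcard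
    have hunion : C ∪ B' = (D' : Set α) :=
      Set.eq_of_subset_of_ncard_le hunion_sub (by rw [hunion_card, hD'ncard]) D'.finite_toSet
    have hC3 : 3 ≤ C.ncard := by
      have := hcirc C hC
      rw [← hCfin.cast_ncard_eq] at this
      exact_mod_cast this
    have hCle : C.ncard ≤ q + 1 := by omega
    have hD'B' : (D' : Set α) ⊆ B := by rw [← hBfcoe]; exact_mod_cast hD'B
    refine ⟨(C, B'), ?_, ?_⟩
    · rw [Finset.mem_coe, Finset.mem_filter, hP, Finset.mem_filter]
      refine ⟨⟨?_, hdisj, ?_⟩, ?_⟩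
      · rw [Finset.mem_biUnion]
        refine ⟨C.ncard, by rw [Finset.mem_Icc]; exact ⟨hC3, hCle⟩, ?_⟩
        rw [Finset.mem_product]
        refine ⟨?_, hmem𝓑 _ _ (hB'D.trans hD'E) (by show B'.ncard = q + 1 - C.ncard; omega)⟩
        rw [h𝒞, Set.Finite.mem_toFinset]; exact ⟨hC, rfl⟩
      · show M.eRk (C ∪ B') = q
        rw [hunion]; exact hD'q
      · show C ∪ B' ⊆ B
        rw [hunion]; exact hD'B'
    · exact hunion
  -- (5) the double count: `Σ_{B ∈ Uf} #{p ∈ P : p ⊆ B} = Σ_{p ∈ P} #{B ∈ Uf : p ⊆ B}`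
  have hdouble : ∑ B ∈ Uf, (P.filter (fun p => p.1 ∪ p.2 ⊆ B)).card =
      ∑ p ∈ P, (Uf.filter (fun B => p.1 ∪ p.2 ⊆ B)).card := by
    simp only [Finset.card_filter]
    exact Finset.sum_comm
  -- assemble
  have hleft : (j₀ * ((m - q).choose j₀ - (2 ^ (j₀ - 1) - j₀) * (m - q).choose (j₀ - 1))) * Uf.card ≤
      ∑ B ∈ Uf, (P.filter (fun p => p.1 ∪ p.2 ⊆ B)).card := by
    calc (j₀ * ((m - q).choose j₀ - (2 ^ (j₀ - 1) - j₀) * (m - q).choose (j₀ - 1))) * Uf.card =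
          ∑ _B ∈ Uf, (j₀ * ((m - q).choose j₀ - (2 ^ (j₀ - 1) - j₀) * (m - q).choose (j₀ - 1))) := by
          rw [Finset.sum_const, smul_eq_mul, mul_comm]
      _ ≤ ∑ B ∈ Uf, (P.filter (fun p => p.1 ∪ p.2 ⊆ B)).card := Finset.sum_le_sum hlow
  have hright : ∑ p ∈ P, (Uf.filter (fun B => p.1 ∪ p.2 ⊆ B)).card ≤
      Nat.choose (f' - q) (m - (q + 1)) * P.card + Nat.choose (f - (q + 1)) (m - (q + 1)) * Pbig.card := by
    have hsum : ∑ p ∈ P, (Uf.filter (fun B => p.1 ∪ p.2 ⊆ B)).card =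
        ∑ p ∈ Psmall, (Uf.filter (fun B => p.1 ∪ p.2 ⊆ B)).card +
          ∑ p ∈ Pbig, (Uf.filter (fun B => p.1 ∪ p.2 ⊆ B)).card := by
      rw [hPsmall, hPbig]
      exact (Finset.sum_filter_add_sum_filter_not P _ _).symm
    rw [hsum]
    calc ∑ p ∈ Psmall, (Uf.filter (fun B => p.1 ∪ p.2 ⊆ B)).card +
          ∑ p ∈ Pbig, (Uf.filter (fun B => p.1 ∪ p.2 ⊆ B)).card
        ≤ ∑ _p ∈ Psmall, Nat.choose (f' - q) (m - (q + 1)) +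
            ∑ _p ∈ Pbig, Nat.choose (f - (q + 1)) (m - (q + 1)) :=
          add_le_add (Finset.sum_le_sum hfib_small) (Finset.sum_le_sum hfib_big)
      _ = Psmall.card * Nat.choose (f' - q) (m - (q + 1)) + Pbig.card * Nat.choose (f - (q + 1)) (m - (q + 1)) := by
          rw [Finset.sum_const, smul_eq_mul, Finset.sum_const, smul_eq_mul]
      _ ≤ _ := by
          rw [mul_comm Psmall.card, mul_comm Pbig.card]
          exact add_le_add (Nat.mul_le_mul_left _ hPsmallcard) le_rfl
  rw [← hUfcard]
  calc (j₀ * ((m - q).choose j₀ - (2 ^ (j₀ - 1) - j₀) * (m - q).choose (j₀ - 1))) * Uf.card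
      ≤ ∑ B ∈ Uf, (P.filter (fun p => p.1 ∪ p.2 ⊆ B)).card := hleft
    _ = ∑ p ∈ P, (Uf.filter (fun B => p.1 ∪ p.2 ⊆ B)).card := hdouble
    _ ≤ Nat.choose (f' - q) (m - (q + 1)) * P.card + Nat.choose (f - (q + 1)) (m - (q + 1)) * Pbig.card := hright
    _ ≤ _ := add_le_add (Nat.mul_le_mul_left _ hPcard) (Nat.mul_le_mul_left _ hPbigcard)

end Matroid

end PercRepro
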